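import Summits.ResolutionOfSingularities.ResolutionOfSingularities.Theorems.WeightedInvariantIota3LemmaCPrimeVanishing
import HarnessLib

/-!
# LEMMA C′ in iterated-polynomial form, II: the case `r₂ ∣ r₁` (root curve, shift `Y ↦ Y + aV^ρ`, vanishing lemma)
# (door `HypersurfaceCentreConstruction`, stmt-ResolutionOfSingularities-19897; proof of LEMMA C′, memo RESIDUE-PLAN.md §3b)

Helper for `stub_keyRungGrHomLE_three` (def-free, `--supports 19897`).  In `κ[X][V][Y]` (see …Iota3LemmaCPrimeVanishing for
the set-up): for a pure `P = Σ_c λ_c V^{ρ(ν − c)} Y^c` (`ρ = r₁/r₂ ∈ ℕ`, `λ_ν ≠ 0`) with `P(V, Y) = P(V + T, Y + τ)`, `T = εX^j`: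
(1) `V = Y = 0` gives the root curve `Σ_c λ_c W^{ν−c} τ(X,0)^c = 0`, `W = T^ρ`, so `τ(X, 0) = aW` with `Σ λ_c a^c = 0`
(`Polynomial3.exists_root_of_rootCurve`); (2) `P₂ := P(V, Y + aV^ρ)` is pure of the same type (`coeff_taylor_shift`), satisfies the
functional equation with `τ₂ = τ + aV^ρ − a(V+T)^ρ`, `τ₂(X, 0) = 0`, and `Y ∣ P₂`; (3) the vanishing lemma gives `τ₂ = 0`, then
`P₂ = λ_ν Y^ν`, i.e. **`core_of_dvd`**: `P = λ_ν (Y − aV^ρ)^ν`.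
[OURS · L1 W4.3 · (o70-b)/(Δ12); AI work, weaker than expert review; nothing here is a statement of the manuscript under review.]
-/

noncomputable section

open Polynomial

set_option linter.dupNamespace false -- mandated namespace of this single-conjunct summit

namespace Summit.ResolutionOfSingularities.ResolutionOfSingularities.Cruxes.HypersurfaceCentreConstruction.LocalEngine

namespace Iota3

namespace LemmaCPrime

variable {κ : Type} [Field κ]

/-- `map` along a ring morphism transports the Taylor shift: `(taylor r f).map φ = taylor (φ r) (f.map φ)`. [folklore] -/
theorem map_taylor {R S : Type} [CommRing R] [CommRing S] (φ : R →+* S) (r : R) (f : R[X]) :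
    (taylor r f).map φ = taylor (φ r) (f.map φ) := by
  rw [taylor_apply, taylor_apply, map_comp, Polynomial.map_add, map_X, map_C]

/-- **The coefficients of the shifted polynomial** `P(V, Y + aV^ρ)` for a pure `P = Σ_c λ_c V^{ρ(ν−c)} Y^c`: they are
`(Σ_i λ_i (i choose c) a^{i−c}) V^{ρ(ν−c)}` — pure of the same type. [folklore] -/
theorem coeff_taylor_shift {ν ρ : ℕ} {lam : ℕ → κ} {ex : ℕ → ℕ} {P : κ[X][X][X]}
    (hP : ∀ c, P.coeff c = monomial (ex c) (C (lam c))) (hexν : ∀ c, lam c ≠ 0 → c ≤ ν)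
    (hexρ : ∀ c, lam c ≠ 0 → ex c = ρ * (ν - c)) (a : κ) (c : ℕ) :
    (taylor (C (C a) * X ^ ρ) P).coeff c =
      monomial (ρ * (ν - c)) (C (∑ i ∈ Finset.range (ν + 1), lam i * (i.choose c : κ) * a ^ (i - c))) := by
  classical
  have hdeg : P.natDegree < ν + 1 := by
    refine lt_of_le_of_lt ?_ (Nat.lt_succ_self ν)
    rw [natDegree_le_iff_coeff_eq_zero]
    intro i hi
    have hl : lam i = 0 := by
      by_contra h; exact absurd (hexν i h) (not_le.mpr (by exact_mod_cast hi))
    rw [hP i, hl, map_zero, map_zero]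
  conv_lhs => rw [as_sum_range' P (ν + 1) hdeg]
  rw [map_sum, finsetSum_coeff, map_sum C, map_sum (monomial (ρ * (ν - c)))]
  refine Finset.sum_congr rfl fun i hi => ?_
  have hiν : i ≤ ν := Nat.lt_succ_iff.mp (Finset.mem_range.mp hi)
  rw [taylor_monomial, coeff_C_mul, coeff_X_add_C_pow, hP i]
  by_cases hl : lam i = 0
  · rw [hl, map_zero, map_zero, zero_mul, zero_mul, zero_mul, map_zero, map_zero]
  by_cases hic : i < c
  · rw [Nat.choose_eq_zero_of_lt hic, Nat.cast_zero, Nat.cast_zero, mul_zero, mul_zero, mul_zero, zero_mul, map_zero,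
      map_zero]
  have hci : c ≤ i := not_lt.mp hic
  rw [hexρ i hl, ← C_mul_X_pow_eq_monomial, ← C_mul_X_pow_eq_monomial,
    show ρ * (ν - c) = ρ * (ν - i) + ρ * (i - c) by rw [← Nat.mul_add]; congr 1; omega, pow_add, mul_pow, ← pow_mul,
    ← map_natCast (C : κ[X] →+* κ[X][X]), ← map_natCast (C : κ →+* κ[X])]
  simp only [map_mul, map_pow]
  ring

/-- The shifted coefficient family vanishes above `ν`. [folklore] -/
theorem shift_lam_le {ν : ℕ} (lam : ℕ → κ) (a : κ) (c : ℕ)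
    (h : ∑ i ∈ Finset.range (ν + 1), lam i * (i.choose c : κ) * a ^ (i - c) ≠ 0) : c ≤ ν := by
  by_contra hc
  refine h (Finset.sum_eq_zero fun i hi => ?_)
  rw [Nat.choose_eq_zero_of_lt (by have := Finset.mem_range.mp hi; omega), Nat.cast_zero, mul_zero, zero_mul]

/-- The top shifted coefficient is `λ_ν`. [folklore] -/
theorem shift_lam_top {ν : ℕ} (lam : ℕ → κ) (a : κ) :
    ∑ i ∈ Finset.range (ν + 1), lam i * (i.choose ν : κ) * a ^ (i - ν) = lam ν := by
  rw [Finset.sum_eq_single ν (fun i hi hiν => by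
      rw [Nat.choose_eq_zero_of_lt (lt_of_le_of_ne (Nat.lt_succ_iff.mp (Finset.mem_range.mp hi)) hiν), Nat.cast_zero,
        mul_zero, zero_mul])
    (fun h => absurd (Finset.mem_range.mpr (Nat.lt_succ_self ν)) h)]
  simp

/-- **LEMMA C′ WHEN `r₂ ∣ r₁`.**  A pure `P = Σ_c λ_c V^{e_c} Y^c` (`r₂ e_c = r₁(ν − c)` when `λ_c ≠ 0`, `λ_ν ≠ 0`, `1 ≤ ν`) with
`P(V, Y) = P(V + εX^j, Y + τ)` (`ε ≠ 0`, `j ≥ 1`, `τ ∈ κ[X][V]`) and `r₂ ∣ r₁` is `λ_ν (Y − a V^{r₁/r₂})^ν` for some `a ∈ κ`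
(root curve + shift + vanishing lemma, RESIDUE-PLAN.md §3b). [OURS · L1 W4.3 · (o70-b)/(Δ12)] -/
theorem core_of_dvd {r₁ r₂ ν : ℕ} (hr₂ : 0 < r₂) (hr : r₂ < r₁) (hν1 : 1 ≤ ν) (hdvd : r₂ ∣ r₁)
    {lam : ℕ → κ} {ex : ℕ → ℕ} {P : κ[X][X][X]} (hP : ∀ c, P.coeff c = monomial (ex c) (C (lam c)))
    (hex : ∀ c, lam c ≠ 0 → c ≤ ν ∧ r₂ * ex c = r₁ * (ν - c)) (hν : lam ν ≠ 0)
    {ε : κ} (hε : ε ≠ 0) {j : ℕ} (hj : 1 ≤ j) {τ : κ[X][X]}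
    (hfe : P = taylor τ (P.map (taylorAlgHom (C ε * X ^ j)).toRingHom)) :
    ∃ a : κ, P = C (C (C (lam ν))) * (X - C (C (C a) * X ^ (r₁ / r₂))) ^ ν := by
  classical
  set ρ := r₁ / r₂ with hρdef
  have hρ : r₂ * ρ = r₁ := Nat.mul_div_cancel' hdvd
  have hρ1 : 1 ≤ ρ := by
    rw [hρdef]; exact (Nat.one_le_div_iff hr₂).mpr hr.le
  set T : κ[X] := C ε * X ^ j with hT
  have hT0 : T ≠ 0 := T_ne_zero hε j
  have hTdeg : T.natDegree = j := by rw [hT, natDegree_C_mul_X_pow j _ hε]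
  set W : κ[X] := T ^ ρ with hW
  have hWdeg : 0 < W.natDegree := by
    rw [hW, natDegree_pow, hTdeg]; exact Nat.mul_pos (by omega) (by omega)
  have hexρ : ∀ c, lam c ≠ 0 → ex c = ρ * (ν - c) := by
    intro c hl
    have h := (hex c hl).2
    rw [← hρ, mul_assoc] at h
    exact Nat.eq_of_mul_eq_mul_left hr₂ h
  have hexν : ∀ c, lam c ≠ 0 → c ≤ ν := fun c hl => (hex c hl).1
  -- Step 1: the root curve at `V = Y = 0`
  set τ₀ : κ[X] := τ.eval 0 with hτ₀
  have RC : ∑ c ∈ Finset.range (ν + 1), C (lam c) * W ^ (ν - c) * τ₀ ^ c = 0 := by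
    have h := congr_arg (eval 0) (fe_eval_zero hP hex hfe)
    rw [eval_monomial, eval_finsetSum] at h
    have hl : C (lam 0) * (0 : κ[X]) ^ ex 0 = 0 := by
      by_cases h0 : lam 0 = 0
      · rw [h0, map_zero, zero_mul]
      · rw [hexρ 0 h0, Nat.sub_zero, zero_pow (Nat.mul_ne_zero (by omega) (by omega)), mul_zero]
    rw [hl] at h
    rw [h]
    refine Finset.sum_congr rfl fun c _ => ?_
    rw [eval_mul, eval_mul, eval_C, eval_pow, eval_pow, eval_add, eval_X, eval_C, zero_add]
    by_cases hl : lam c = 0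
    · rw [hl, map_zero, zero_mul, zero_mul, zero_mul, zero_mul]
    · rw [hexρ c hl, pow_mul]
  obtain ⟨a, ha, hroot⟩ := Polynomial3.exists_root_of_rootCurve ν lam hν W τ₀ hWdeg RC
  -- Step 2: the shift `Y ↦ Y + aV^ρ`
  set α : κ[X][X] := C (C a) * X ^ ρ with hα
  set P₂ : κ[X][X][X] := taylor α P with hP₂
  set lam₂ : ℕ → κ := fun c => ∑ i ∈ Finset.range (ν + 1), lam i * (i.choose c : κ) * a ^ (i - c) with hlam₂
  have hP₂c : ∀ c, P₂.coeff c = monomial (ρ * (ν - c)) (C (lam₂ c)) := fun c => coeff_taylor_shift hP hexν hexρ a c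
  have hex₂ : ∀ c, lam₂ c ≠ 0 → c ≤ ν ∧ r₂ * (ρ * (ν - c)) = r₁ * (ν - c) := fun c hl =>
    ⟨shift_lam_le lam a c hl, by rw [← mul_assoc, hρ]⟩
  have hν₂ : lam₂ ν ≠ 0 := by
    show ∑ i ∈ Finset.range (ν + 1), lam i * (i.choose ν : κ) * a ^ (i - ν) ≠ 0
    rw [shift_lam_top]; exact hν
  have hlam₂0 : lam₂ 0 = 0 := by
    show ∑ i ∈ Finset.range (ν + 1), lam i * (i.choose 0 : κ) * a ^ (i - 0) = 0
    simp only [Nat.choose_zero_right, Nat.cast_one, mul_one, Nat.sub_zero]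
    exact hroot
  set τ₂ : κ[X][X] := τ + α - taylor T α with hτ₂
  have hfe₂ : P₂ = taylor τ₂ (P₂.map (taylorAlgHom T).toRingHom) := by
    rw [hP₂, map_taylor, taylor_taylor, hτ₂, AlgHom.toRingHom_eq_coe, AlgHom.coe_toRingHom, taylorAlgHom_apply,
      sub_add_cancel, add_comm τ α, ← taylor_taylor]
    congr 1
  have hτ₂0 : τ₂.coeff 0 = 0 := by
    rw [hτ₂, coeff_sub, coeff_add, coeff_zero_eq_eval_zero, coeff_zero_eq_eval_zero, coeff_zero_eq_eval_zero, ← hτ₀, ha,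
      hα, taylor_mul, taylor_C, taylor_pow, taylor_X, eval_mul, eval_C, eval_pow, eval_X, eval_mul, eval_C, eval_pow,
      eval_add, eval_X, eval_C, zero_add, hW, zero_pow (by omega), mul_zero, add_zero, sub_self]
  -- Step 3: vanishing lemma, then `τ₂ = 0` forces `P₂ = λ_ν Y^ν`
  have hτ₂eq : τ₂ = 0 := tau_eq_zero_of_lam_zero hr₂ hP₂c hex₂ hν₂ hlam₂0 hε hfe₂ (Or.inr hτ₂0)
  rw [hτ₂eq] at hfe₂
  have hlam₂ := lam_eq_zero_of_tau_eq_zero hr hP₂c hex₂ hε hfe₂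
  have hP₂eq : P₂ = C (C (C (lam ν))) * X ^ ν := by
    refine Polynomial.ext fun c => ?_
    rw [hP₂c c, coeff_C_mul_X_pow]
    split_ifs with hc
    · rw [hc, Nat.sub_self, mul_zero, monomial_zero_left]
      show C (C (lam₂ ν)) = C (C (lam ν))
      congr 2
      show ∑ i ∈ Finset.range (ν + 1), lam i * (i.choose ν : κ) * a ^ (i - ν) = lam ν
      exact shift_lam_top lam a
    · rcases lt_or_gt_of_ne hc with hlt | hgt
      · rw [hlam₂ c hlt, map_zero, map_zero]
      · have : lam₂ c = 0 := by
          by_contra h; exact absurd (hex₂ c h).1 (not_le.mpr hgt)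
        rw [this, map_zero, map_zero]
  refine ⟨a, ?_⟩
  calc P = taylor (-α) P₂ := by rw [hP₂, taylor_taylor, neg_add_cancel, taylor_zero]
    _ = C (C (C (lam ν))) * (X - C α) ^ ν := by
        rw [hP₂eq, taylor_mul, taylor_C, taylor_pow, taylor_X, map_neg]
        ring

end LemmaCPrime

end Iota3

end Summit.ResolutionOfSingularities.ResolutionOfSingularities.Cruxes.HypersurfaceCentreConstruction.LocalEngine

end
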